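import Summits.CriticalPhenomena.PercolationContinuityZ3.Theorems.PercNearOneGluingNoHeavyLowerTailSahiSlotPairConeTopSandwich
import Summits.CriticalPhenomena.PercolationContinuityZ3.Theorems.PercNearOneGluingNoHeavyLowerTailSahiGridPatternOrthantHarrisLifts
import Summits.CriticalPhenomena.PercolationContinuityZ3.Theorems.PercNearOneGluingNoHeavyLowerTailSahiGridPatternTwoAxisPrelim

/-!
# THE THRESHOLD-TOP SANDWICH LIFT: `PinnedGood (n+1) X → X ⊆ Θ → PinnedGood (n+2) (X × {1} ∪ Θ × {2})`, `Θ = {x : x_last ≥ 1}` —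
# the first universal pivotal-pair certificate for a MIXED chain `(∅, X, E)` with `X ⊊ E ≠ ⊤`, in every dimension

Support file of the one-cut programme (crux `NoHeavyLowerTail`, stmt-CriticalPhenomena-4575; cell `prim-masterthm`, seat P3, gen 24;
`run/shared/lean/prim/prim-masterthm/prim-masterthm-p3/HIERARCHY.md` §32(b'), memo `FROM-prim-masterthm-p3-g24-CERTIFICATE-RULES.md` §0bis).

CONTEXT.  Along the last axis an up-set of `[3]^{m+1}` is a chain `(A₀, A₁, A₂)` of up-sets of `[3]^m`.  The pure lifts `(∅,D,D)`, `(∅,∅,E)`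
(gen 23) and the top sandwich `(∅,D,⊤)` (`…PairConeTopSandwich`) have universal certificates; the general mixed chain `(∅,D,E)` has none in any
typed atom dictionary tried (gens 23–24).  A census over all tops `E ⊆ [3]^2` (gen 24) singled out, besides `⊤`, exactly the CO-BOTTOM
THRESHOLDS `Θ_a = {x : x_a ≥ 1}`: for every up-set `X ⊆ Θ_a` the chain `(∅, X, Θ_a)` has a typed universal certificate.  THIS FILE proves it
for the last base axis (`Θ = Thr n = liftTwo ⊤ ⊆ [3]^{n+1}`), in every dimension:
* two-axis bookkeeping: `fsl` (slice of a function) and the SPLITTING of the typed atoms of `…PairConeLifts` along the last base axis,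
  `Dg_snoc(3)`, `Nf_snoc(6)`, `Lf_snoc(6)` (every `Dg/Nf/Lf` over `[3]^{m+1}` is a signed sum of atoms over `[3]^m` on the slices);
* **`InPairCone.fibreHarris₂`** — the BILINEAR fibre-Harris form `Σ_{q δ̸ p} 1_B(q,j)(1_C(q,k) − 1_C(p̄q,k))` is in the pair cone (gen 22's
  two-member certificate `harrisForm_eq_sum_coverPairs` transported by `Emb p`; the bilinear version of `InCone.fibreHarris`), hence the
  horizontal Harris aggregate `inPairCone_HF` (`Nf W b c − Lf W b c` for any apex weight `W ≥ 0`; `Lf_eq_sum_apex` re-indexes the Latin atom);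
* `Thr n`, `thrSand X := liftTwo X ∪ liftTop (Thr n) = X × {1} ∪ Θ × {2}` (slices `(∅, X, Θ)` when `X ⊆ Θ`), the Kleitman diagonal of the
  threshold `inPairCone_KD_thr` (`2^{n+1}Dg(1_Θ;b,c) − Nf(1_Θ;b,c) = 2^n Σ_{i=1,2}[Dg(1;b_i−b_0,c_i) + Dg(1;b_0,c_i−c_0)]`, explicitly conic);
* **`sStarD_thrSand_eq`** (all finsets `X ⊆ Θ`, `B`, `C`): `3·sStarD (thrSand X) B C = 3·sStarD X B₁ C₁ + 3·sStarD X B₂ C₂ + remThr X B C`,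
  `remThr` = 31 explicit integer-weighted terms (fibre-Kleitman of `X` and `Θ`, horizontal Harris aggregate on the bottom layer `[3]^{n+1} ∖ Θ`,
  Kleitman diagonals of `Θ`, point/increment products with weights `1_X`, `1_Θ`, `1_{Θ∖X}`, `1_{[3]^{n+1}∖X}`, `1`), each in `C ⊗ C`
  (`remThr_inPairCone`), hence **`PinnedGood.thrSand`**, `sStarD_thrSand_nonneg`, and the two-axis instances `pinnedGood_thrSand_liftTop`
  (`D×{(2,1)} ∪ ⊤×{(1,2),(2,2)}`), `pinnedGood_thrSand_topSand` (`D×{(1,1)} ∪ ⊤×{(1,2),(2,1),(2,2)}`).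
The identity was FOUND by the instance-based universal-identity LP of gen 24 (joint fit on all `X ⊆ Θ ⊆ [3]^2` and 40 sampled `X ⊆ [3]^3`;
33 atoms, coefficients in `(1/3)ℤ`), verified by pure evaluation at `[3]^4 → [3]^5` and as a FORMAL identity in the two free slices of `X`, and
is proved here by `ring` after the 18-block expansion, the splitting of every atom along the last base axis (so that `1_Θ` becomes the constants
`(0, 1, 1)`) and the three `univ` relations.  Without the Kleitman-diagonal or without the horizontal-Harris atoms the LP is infeasible — both are
load-bearing.  The rewrite lists of the two large normalisations were generated uniformly and then pruned to the lemmas actually used.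
HONEST LABEL: a certificate-format lift theorem in every dimension (new all-`d` family of good first slots); no open cell changes status.
Pure, standard axioms. [this work]
-/

noncomputable section

namespace Summit.CriticalPhenomena.PercolationContinuityZ3.Theorems

open Finset Function
open Literature.Combinatorics.Sahi2008

namespace SahiSlot

open SahiGridPattern SahiGrid3

variable {n : ℕ}

/-- Slice of a function on `[3]^{n+1}` at last-axis level `i`. [this work] -/
def fsl (f : Pd (n + 1) → ℤ) (i : Fin 3) : Pd n → ℤ := fun q => f (Fin.snoc q i)

/-- `Dg` over `[3]^{n+1}` splits as the sum of the three level-diagonal `Dg` over `[3]^n`. [this work] -/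
theorem Dg_snoc (f g h : Pd (n + 1) → ℤ) : Dg f g h = ∑ i : Fin 3, Dg (fsl f i) (fsl g i) (fsl h i) := by
  unfold Dg fsl
  rw [sum_snoc]

/-- `Nf` over `[3]^{n+1}` splits over the level pairs `(i, j)`, `i ≠ j`. [this work] -/
theorem Nf_snoc (f g h : Pd (n + 1) → ℤ) :
    Nf f g h = ∑ i : Fin 3, ∑ j : Fin 3, (if i ≠ j then (1:ℤ) else 0) * Nf (fsl f i) (fsl g j) (fsl h j) := by
  unfold Nf fsl
  simp only [sum_snoc]
  refine Finset.sum_congr rfl fun i _ => ?_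
  rw [Finset.sum_comm]
  refine Finset.sum_congr rfl fun j _ => ?_
  rw [Finset.mul_sum]
  refine Finset.sum_congr rfl fun p _ => ?_
  rw [Finset.mul_sum]
  refine Finset.sum_congr rfl fun q _ => ?_
  rw [ite_totDist_snoc]
  ring

/-- `Lf` over `[3]^{n+1}` splits over the level pairs `(j, k)`, `j ≠ k`, the weight read at level `−(j+k)` (the third level). [this work] -/
theorem Lf_snoc (f g h : Pd (n + 1) → ℤ) :
    Lf f g h = ∑ j : Fin 3, ∑ k : Fin 3, (if j ≠ k then (1:ℤ) else 0) * Lf (fsl f (-(j + k))) (fsl g j) (fsl h k) := by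
  unfold Lf fsl
  simp only [sum_snoc]
  refine Finset.sum_congr rfl fun j _ => ?_
  rw [Finset.sum_comm]
  refine Finset.sum_congr rfl fun k _ => ?_
  rw [Finset.mul_sum]
  refine Finset.sum_congr rfl fun q _ => ?_
  rw [Finset.mul_sum]
  refine Finset.sum_congr rfl fun r _ => ?_
  rw [ite_totDist_snoc, thirdPt_snoc]
  ring

/-- The co-bottom threshold `Θ = {x ∈ [3]^{n+1} : x_last ≥ 1} = [3]^n × {1,2}`. [this work] -/
def Thr (n : ℕ) : Finset (Pd (n + 1)) := liftTwo (univ : Finset (Pd n))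

/-- The threshold `Θ` is an up-set. [this work] -/
theorem isUpperSet_Thr (n : ℕ) : IsUpperSet ((Thr n : Finset (Pd (n + 1))) : Set (Pd (n + 1))) :=
  isUpperSet_liftTwo (by rw [Finset.coe_univ]; exact isUpperSet_univ)
/-- Bottom slice of `Θ` is empty. [this work] -/ theorem sl_Thr_zero (n : ℕ) : sl (Thr n) 0 = ∅ := sl_liftTwo_zero _
/-- Middle slice of `Θ` is everything. [this work] -/ theorem sl_Thr_one (n : ℕ) : sl (Thr n) 1 = univ := sl_liftTwo_one _
/-- Top slice of `Θ` is everything. [this work] -/ theorem sl_Thr_two (n : ℕ) : sl (Thr n) 2 = univ := sl_liftTwo_two _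

/-- **The threshold-top sandwich** `thrSand X = X × {1} ∪ Θ × {2} ⊆ [3]^{n+2}` (for `X ⊆ Θ`; slices `(∅, X, Θ)`). [this work] -/
def thrSand (X : Finset (Pd (n + 1))) : Finset (Pd (n + 2)) := liftTwo X ∪ liftTop (Thr n)

/-- Bottom slice of the threshold sandwich is empty. [this work] -/
theorem sl_thrSand_zero (X : Finset (Pd (n + 1))) : sl (thrSand X) 0 = ∅ := by
  ext p; simp [thrSand, sl, snoc_mem_liftTwo, snoc_mem_liftTop]
/-- Middle slice of the threshold sandwich is `X`. [this work] -/
theorem sl_thrSand_one (X : Finset (Pd (n + 1))) : sl (thrSand X) 1 = X := by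
  ext p; simp [thrSand, sl, snoc_mem_liftTwo, snoc_mem_liftTop]
/-- Top slice of the threshold sandwich is `Θ` (for `X ⊆ Θ`). [this work] -/
theorem sl_thrSand_two {X : Finset (Pd (n + 1))} (hXT : X ⊆ Thr n) : sl (thrSand X) 2 = Thr n := by
  have h : sl (thrSand X) 2 = X ∪ Thr n := by ext p; simp [thrSand, sl, snoc_mem_liftTwo, snoc_mem_liftTop]
  rw [h]; exact Finset.union_eq_right.2 hXT
/-- The threshold sandwich of an up-set is an up-set. [this work] -/
theorem isUpperSet_thrSand {X : Finset (Pd (n + 1))} (hX : IsUpperSet (X : Set (Pd (n + 1)))) :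
    IsUpperSet ((thrSand X : Finset (Pd (n + 2))) : Set (Pd (n + 2))) := by
  unfold thrSand; rw [Finset.coe_union]
  exact (isUpperSet_liftTwo hX).union (isUpperSet_liftTop (isUpperSet_Thr n))
/-- An up-set inside `Θ` has empty bottom slice. [this work] -/
theorem sl_zero_of_subset_Thr {X : Finset (Pd (n + 1))} (hXT : X ⊆ Thr n) : sl X 0 = ∅ := by
  ext p
  refine ⟨fun h => ?_, fun h => by simp at h⟩
  rw [sl, Finset.mem_filter] at h
  have := hXT h.2
  rw [Thr, snoc_mem_liftTwo] at this
  exact absurd rfl this.2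

/-! ### Bookkeeping for the two-level expansion -/

/-- Slices of an indicator are indicators of slices. [this work] -/
theorem fsl_ind (S : Finset (Pd (n + 1))) (i : Fin 3) : fsl (ind S) i = ind (sl S i) := by
  funext q; exact ind_sl S i q
/-- Slicing is additive. [this work] -/ theorem fsl_sub (f g : Pd (n + 1) → ℤ) (i : Fin 3) : fsl (f - g) i = fsl f i - fsl g i := rfl
/-- Slices of everything are everything. [this work] -/ theorem sl_univ_eq (i : Fin 3) : sl (univ : Finset (Pd (n + 1))) i = univ := by ext p; simp [sl]
/-- The indicator of `∅` is the zero function. [this work] -/ theorem ind_empty_fun : ind (∅ : Finset (Pd n)) = 0 := funext fun p => ind_empty_eq p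
/-- Indicator of a difference of nested finsets, as functions. [this work] -/
theorem ind_sdiff_fun {s t : Finset (Pd n)} (h : s ⊆ t) : ind (t \ s) = ind t - ind s := by
  funext p; rw [Pi.sub_apply]; exact ind_sdiff_of_subset h p
/-- A zero slot kills `Dg`. [this work] -/ theorem Dg_zero₁ (g h : Pd n → ℤ) : Dg 0 g h = 0 := by simp [Dg]
/-- A zero slot kills `Dg`. [this work] -/ theorem Dg_zero₂ (f h : Pd n → ℤ) : Dg f 0 h = 0 := by simp [Dg]
/-- A zero slot kills `Dg`. [this work] -/ theorem Dg_zero₃ (f g : Pd n → ℤ) : Dg f g 0 = 0 := by simp [Dg]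
/-- A zero slot kills `Nf`. [this work] -/ theorem Nf_zero₁ (g h : Pd n → ℤ) : Nf 0 g h = 0 := by simp [Nf]
/-- A zero slot kills `Nf`. [this work] -/ theorem Nf_zero₂ (f h : Pd n → ℤ) : Nf f 0 h = 0 := by simp [Nf]
/-- A zero slot kills `Nf`. [this work] -/ theorem Nf_zero₃ (f g : Pd n → ℤ) : Nf f g 0 = 0 := by simp [Nf]
/-- A zero slot kills `Lf`. [this work] -/ theorem Lf_zero₁ (g h : Pd n → ℤ) : Lf 0 g h = 0 := by simp [Lf]
/-- A zero slot kills `Lf`. [this work] -/ theorem Lf_zero₂ (f h : Pd n → ℤ) : Lf f 0 h = 0 := by simp [Lf]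
/-- A zero slot kills `Lf`. [this work] -/ theorem Lf_zero₃ (f g : Pd n → ℤ) : Lf f g 0 = 0 := by simp [Lf]

/-- `Nf` split along the last axis, six explicit blocks. [this work] -/
theorem Nf_snoc6 (f g h : Pd (n + 1) → ℤ) :
    Nf f g h = Nf (fsl f 0) (fsl g 1) (fsl h 1) + Nf (fsl f 0) (fsl g 2) (fsl h 2) + Nf (fsl f 1) (fsl g 0) (fsl h 0)
      + Nf (fsl f 1) (fsl g 2) (fsl h 2) + Nf (fsl f 2) (fsl g 0) (fsl h 0) + Nf (fsl f 2) (fsl g 1) (fsl h 1) := by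
  rw [Nf_snoc]; simp only [Fin.sum_univ_three]
  rw [if_neg (by decide), if_pos (by decide), if_pos (by decide), if_pos (by decide), if_neg (by decide), if_pos (by decide),
    if_pos (by decide), if_pos (by decide), if_neg (by decide)]
  ring
/-- `Lf` split along the last axis, six explicit blocks. [this work] -/
theorem Lf_snoc6 (f g h : Pd (n + 1) → ℤ) :
    Lf f g h = Lf (fsl f 2) (fsl g 0) (fsl h 1) + Lf (fsl f 1) (fsl g 0) (fsl h 2) + Lf (fsl f 2) (fsl g 1) (fsl h 0)
      + Lf (fsl f 0) (fsl g 1) (fsl h 2) + Lf (fsl f 1) (fsl g 2) (fsl h 0) + Lf (fsl f 0) (fsl g 2) (fsl h 1) := by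
  rw [Lf_snoc]; simp only [Fin.sum_univ_three]
  rw [if_neg (by decide), if_pos (by decide), if_pos (by decide), if_pos (by decide), if_neg (by decide), if_pos (by decide),
    if_pos (by decide), if_pos (by decide), if_neg (by decide)]
  have e01 : (-((0:Fin 3) + 1)) = 2 := by decide
  have e02 : (-((0:Fin 3) + 2)) = 1 := by decide
  have e10 : (-((1:Fin 3) + 0)) = 2 := by decide
  have e12 : (-((1:Fin 3) + 2)) = 0 := by decide
  have e20 : (-((2:Fin 3) + 0)) = 1 := by decide
  have e21 : (-((2:Fin 3) + 1)) = 0 := by decide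
  rw [e01, e02, e10, e12, e20, e21]
  ring
/-- `Dg` split along the last axis, three explicit blocks. [this work] -/
theorem Dg_snoc3 (f g h : Pd (n + 1) → ℤ) :
    Dg f g h = Dg (fsl f 0) (fsl g 0) (fsl h 0) + Dg (fsl f 1) (fsl g 1) (fsl h 1) + Dg (fsl f 2) (fsl g 2) (fsl h 2) := by
  rw [Dg_snoc, Fin.sum_univ_three]

/-! ### The remainder and the identity -/

/-- The explicit remainder of the threshold-top sandwich (31 terms, integer coefficients; `Thr n ∖ X`, `univ ∖ Thr n`, `univ ∖ X` as weights). [this work] -/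
def remThr (X : Finset (Pd (n + 1))) (B C : Finset (Pd (n + 2))) : ℤ :=
  1 * Nf (ind (sl B 0)) (ind X) ((ind (sl C 2)) - (ind (sl C 1)))
  + 2 * Nf (ind (sl B 2)) (ind X) ((ind (sl C 2)) - (ind (sl C 1)))
  + 1 * Nf (ind (sl C 0)) (ind X) ((ind (sl B 2)) - (ind (sl B 1)))
  + 2 * Nf (ind (sl C 2)) (ind X) ((ind (sl B 2)) - (ind (sl B 1)))
  + 1 * Nf ((ind (sl C 2)) - (ind (sl C 1))) (ind X) ((ind (sl B 2)) - (ind (sl B 1)))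
  + 1 * Nf ((ind (sl B 2)) - (ind (sl B 1))) (ind X) ((ind (sl C 2)) - (ind (sl C 1)))
  + 6 * 2 ^ (n + 1) * Dg (ind (Thr n \ X)) (ind (sl B 2)) ((ind (sl C 2)) - (ind (sl C 1)))
  + 6 * 2 ^ (n + 1) * Dg (ind (Thr n \ X)) ((ind (sl B 2)) - (ind (sl B 1))) (ind (sl C 1))
  + 2 * 2 ^ (n + 1) * Dg (ind (univ : Finset (Pd (n + 1)))) (ind (sl B 0)) ((ind (sl C 1)) - (ind (sl C 0)))
  + 2 * 2 ^ (n + 1) * Dg (ind (univ : Finset (Pd (n + 1)))) ((ind (sl B 1)) - (ind (sl B 0))) (ind (sl C 1))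
  + 1 * Nf ((ind (sl C 2)) - (ind (sl C 1))) (ind (univ : Finset (Pd (n + 1)))) ((ind (sl B 2)) - (ind (sl B 1)))
  + 1 * Lf (ind (univ \ X)) ((ind (sl B 2)) - (ind (sl B 1))) ((ind (sl C 1)) - (ind (sl C 0)))
  + 1 * Lf (ind (univ \ X)) ((ind (sl B 2)) - (ind (sl B 1))) ((ind (sl C 2)) - (ind (sl C 0)))
  + 2 * Lf (ind (univ \ X)) ((ind (sl B 2)) - (ind (sl B 0))) ((ind (sl C 2)) - (ind (sl C 1)))
  + 3 * Nf (ind X) (ind (sl B 1)) ((ind (sl C 1)) - (ind (sl C 0)))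
  + 3 * Nf (ind X) ((ind (sl B 1)) - (ind (sl B 0))) (ind (sl C 0))
  + 2 * (Nf ((ind (sl B 1)) - (ind (sl B 0))) (ind X) (ind (sl C 1)) - Lf (ind X) ((ind (sl B 1)) - (ind (sl B 0))) (ind (sl C 1)))
  + 2 * (Nf ((ind (sl C 1)) - (ind (sl C 0))) (ind X) (ind (sl B 1)) - Lf (ind X) (ind (sl B 1)) ((ind (sl C 1)) - (ind (sl C 0))))
  + 1 * (Nf ((ind (sl B 1)) - (ind (sl B 0))) (ind X) (ind (sl C 2)) - Lf (ind X) ((ind (sl B 1)) - (ind (sl B 0))) (ind (sl C 2)))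
  + 1 * (Nf ((ind (sl C 1)) - (ind (sl C 0))) (ind X) (ind (sl B 2)) - Lf (ind X) (ind (sl B 2)) ((ind (sl C 1)) - (ind (sl C 0))))
  + 1 * (Nf ((ind (sl B 2)) - (ind (sl B 1))) (ind (Thr n)) (ind (sl C 0)) - Lf (ind (Thr n)) ((ind (sl B 2)) - (ind (sl B 1))) (ind (sl C 0)))
  + 1 * (Nf ((ind (sl C 2)) - (ind (sl C 1))) (ind (Thr n)) (ind (sl B 0)) - Lf (ind (Thr n)) (ind (sl B 0)) ((ind (sl C 2)) - (ind (sl C 1))))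
  + 2 * (Nf ((ind (sl B 2)) - (ind (sl B 1))) (ind (Thr n)) (ind (sl C 2)) - Lf (ind (Thr n)) ((ind (sl B 2)) - (ind (sl B 1))) (ind (sl C 2)))
  + 2 * (Nf ((ind (sl C 2)) - (ind (sl C 1))) (ind (Thr n)) (ind (sl B 2)) - Lf (ind (Thr n)) (ind (sl B 2)) ((ind (sl C 2)) - (ind (sl C 1))))
  + 1 * (Nf ((ind (sl B 2)) - (ind (sl B 0))) (ind (Thr n)) (ind (sl C 1)) - Lf (ind (Thr n)) ((ind (sl B 2)) - (ind (sl B 0))) (ind (sl C 1)))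
  + 1 * (Nf ((ind (sl C 2)) - (ind (sl C 0))) (ind (Thr n)) (ind (sl B 1)) - Lf (ind (Thr n)) (ind (sl B 1)) ((ind (sl C 2)) - (ind (sl C 0))))
  + 2 * (Nf ((ind (sl B 2)) - (ind (sl B 0))) (ind (Thr n)) (ind (sl C 2)) - Lf (ind (Thr n)) ((ind (sl B 2)) - (ind (sl B 0))) (ind (sl C 2)))
  + 2 * (Nf ((ind (sl C 2)) - (ind (sl C 0))) (ind (Thr n)) (ind (sl B 2)) - Lf (ind (Thr n)) (ind (sl B 2)) ((ind (sl C 2)) - (ind (sl C 0))))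
  + 12 * (Nf (ind (univ \ Thr n)) (ind (sl B 2)) (ind (sl C 2)) - Lf (ind (univ \ Thr n)) (ind (sl B 2)) (ind (sl C 2)))
  + 1 * (2 ^ (n + 1) * Dg (ind (Thr n)) (ind (sl B 0)) (ind (sl C 0)) - Nf (ind (Thr n)) (ind (sl B 0)) (ind (sl C 0)))
  + 5 * (2 ^ (n + 1) * Dg (ind (Thr n)) (ind (sl B 1)) (ind (sl C 1)) - Nf (ind (Thr n)) (ind (sl B 1)) (ind (sl C 1)))


set_option maxHeartbeats 4000000 in
/-- **THE THRESHOLD-TOP SANDWICH IDENTITY** (every `n`, all finsets `X ⊆ Θ`, `B`, `C`):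
`3·sStarD (X×{1} ∪ Θ×{2}) B C = 3·sStarD X B₁ C₁ + 3·sStarD X B₂ C₂ + remThr X B C`. [this work] -/
theorem sStarD_thrSand_eq {X : Finset (Pd (n + 1))} (hXT : X ⊆ Thr n) (B C : Finset (Pd (n + 2))) :
    3 * sStarD (thrSand X) B C = 3 * sStarD X (sl B 1) (sl C 1) + 3 * sStarD X (sl B 2) (sl C 2) + remThr X B C := by
  have ss : ∀ f : Pd (n + 2) → ℤ, ∑ x, f x = ∑ i : Fin 3, ∑ p : Pd (n + 1), f (Fin.snoc p i) := fun f => sum_snoc f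
  rw [sStarD_eq_sum_ind]
  simp only [ss, Fin.sum_univ_three, ind_sl, sl_thrSand_zero, sl_thrSand_one, sl_thrSand_two hXT, ind_empty_eq, zero_mul,
    Finset.sum_const_zero, zero_add, Finset.sum_add_distrib]
  rw [block_eq_atoms, block_eq_atoms, block_eq_atoms, block_eq_atoms, block_eq_atoms, block_eq_atoms, block_eq_atoms, block_eq_atoms,
    block_eq_atoms, block_eq_atoms, block_eq_atoms, block_eq_atoms, block_eq_atoms, block_eq_atoms, block_eq_atoms, block_eq_atoms,
    block_eq_atoms, block_eq_atoms]
  obtain ⟨h0, h1, h2, h3, h4, h5, h6, h7, h8, h9, h10, h11, h12, h13, h14, h15, h16, h17, h18, h19, h20, h21, h22, h23, h24, h25, h26, h27, h28, h29, h30, h31, h32, h33, h34, h35, h36, h37, h38, h39, h40, h41, h42, h43, h44, h45, h46, h47, h48, h49, h50, h51, h52, h53, h54, h55, h56, h57, h58, h59⟩ := c_vals_liftTwo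
  simp only [h0, h1, h2, h3, h4, h5, h6, h7, h8, h9, h10, h11, h12, h13, h14, h15, h16, h17, h18, h19, h20, h21, h22, h23, h24, h25, h26, h27, h28, h29, h30, h31, h32, h33, h34, h35, h36, h37, h38, h39, h40, h41, h42, h43, h44, h45, h46, h47, h48, h49, h50, h51, h52, h53, h54, h55, h56, h57, h58, h59]
  rw [sStarD_counting_atoms, sStarD_counting_atoms]
  simp (maxSteps := 20000000) only [remThr, ind_sdiff_fun hXT, ind_univ_sdiff, Dg_sub₁, Dg_sub₂, Dg_sub₃, Nf_sub₁, Nf_sub₂, Nf_sub₃, Lf_sub₁, Lf_sub₂, Lf_sub₃]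
  simp (maxSteps := 20000000) only [Dg_snoc3, Nf_snoc6, Lf_snoc6]
  simp (maxSteps := 20000000) only [fsl_ind, sl_zero_of_subset_Thr hXT, Thr, sl_liftTwo_zero, sl_liftTwo_one, sl_liftTwo_two, sl_univ_eq]
  simp (maxSteps := 20000000) only [ind_empty_fun, Dg_zero₁, Nf_zero₁, Nf_zero₂, Lf_zero₁, sub_zero, zero_sub,
    zero_mul, add_zero, zero_add]
  simp (maxSteps := 20000000) only [Nf_univ₁, Nf_univ₂]
  simp (maxSteps := 20000000) only [Lf_univ_comm (ind (sl (sl C 0) 0)) (ind (sl (sl B 1) 1)), Lf_univ_comm (ind (sl (sl C 0) 0)) (ind (sl (sl B 1) 2)), Lf_univ_comm (ind (sl (sl C 0) 0)) (ind (sl (sl B 2) 1)), Lf_univ_comm (ind (sl (sl C 0) 0)) (ind (sl (sl B 2) 2)), Lf_univ_comm (ind (sl (sl C 0) 1)) (ind (sl (sl B 1) 2)), Lf_univ_comm (ind (sl (sl C 0) 1)) (ind (sl (sl B 2) 2)), Lf_univ_comm (ind (sl (sl C 0) 2)) (ind (sl (sl B 1) 1)), Lf_univ_comm (ind (sl (sl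 C 0) 2)) (ind (sl (sl B 2) 1)), Lf_univ_comm (ind (sl (sl C 1) 0)) (ind (sl (sl B 0) 1)), Lf_univ_comm (ind (sl (sl C 1) 0)) (ind (sl (sl B 0) 2)), Lf_univ_comm (ind (sl (sl C 1) 0)) (ind (sl (sl B 1) 1)), Lf_univ_comm (ind (sl (sl C 1) 0)) (ind (sl (sl B 1) 2)), Lf_univ_comm (ind (sl (sl C 1) 0)) (ind (sl (sl B 2) 1)), Lf_univ_comm (ind (sl (sl C 1) 0)) (ind (sl (sl B 2) 2)), Lf_univ_comm (ind (sl (sl C 1) 1)) (ind (sl (sl B 0) 2)), Lf_univ_comm (ind (sl (sl C 1) 1)) (ind (sl (sl B 1) 0)), Lf_univ_comm (ind (sl (sl C 1) 1)) (ind (sl (sl B 1) 2)), Lf_univ_comm (ind (sl (sl C 1) 1)) (ind (sl (sl B 2) 0)), Lf_univ_comm (ind (sl (sl C 1) 1)) (ind (sl (sl B 2) 2)), Lf_univ_comm (ind (sl (sl C 1) 2)) (ind (sl (sl B 0) 1)), Lf_univ_comm (ind (sl (sl C 1) 2)) (ind (sl (sl B 1) 0)), Lf_univ_comm (ind (sl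 (sl C 1) 2)) (ind (sl (sl B 1) 1)), Lf_univ_comm (ind (sl (sl C 1) 2)) (ind (sl (sl B 2) 0)), Lf_univ_comm (ind (sl (sl C 1) 2)) (ind (sl (sl B 2) 1)), Lf_univ_comm (ind (sl (sl C 2) 0)) (ind (sl (sl B 0) 1)), Lf_univ_comm (ind (sl (sl C 2) 0)) (ind (sl (sl B 0) 2)), Lf_univ_comm (ind (sl (sl C 2) 0)) (ind (sl (sl B 1) 1)), Lf_univ_comm (ind (sl (sl C 2) 0)) (ind (sl (sl B 1) 2)), Lf_univ_comm (ind (sl (sl C 2) 0)) (ind (sl (sl B 2) 1)), Lf_univ_comm (ind (sl (sl C 2) 0)) (ind (sl (sl B 2) 2)), Lf_univ_comm (ind (sl (sl C 2) 1)) (ind (sl (sl B 0) 2)), Lf_univ_comm (ind (sl (sl C 2) 1)) (ind (sl (sl B 1) 0)), Lf_univ_comm (ind (sl (sl C 2) 1)) (ind (sl (sl B 1) 2)), Lf_univ_comm (ind (sl (sl C 2) 1)) (ind (sl (sl B 2) 0)), Lf_univ_comm (ind (sl (sl C 2) 1)) (ind (sl (sl B 2) 2)), Lf_univ_comm (ind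 (sl (sl C 2) 2)) (ind (sl (sl B 0) 1)), Lf_univ_comm (ind (sl (sl C 2) 2)) (ind (sl (sl B 1) 0)), Lf_univ_comm (ind (sl (sl C 2) 2)) (ind (sl (sl B 1) 1)), Lf_univ_comm (ind (sl (sl C 2) 2)) (ind (sl (sl B 2) 0)), Lf_univ_comm (ind (sl (sl C 2) 2)) (ind (sl (sl B 2) 1))]
  ring

/-! ### The remainder is in the pair cone -/

/-- **Bilinear fibre Harris**: for a point `p` and levels `j, k`, the form `Σ_{q δ̸ p} 1_B(q,j)·(1_C(q,k) − 1_C(p̄q,k))` on `[3]^{n+1}` is in the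
pair cone — gen 22's two-member Harris-form certificate `harrisForm_eq_sum_coverPairs` on the Boolean cube of points totally distinct from `p`,
both members transported by `Emb p` (the bilinear version of `InCone.fibreHarris`). [this work] -/
theorem InPairCone.fibreHarris₂ (p : Pd n) (j k : Fin 3) :
    InPairCone (n + 1) (fun B C => ∑ q, (if TotDist p q = true then (1:ℝ) else 0) *
      (setInd B (Fin.snoc q j) * (setInd C (Fin.snoc q k) - setInd C (Fin.snoc (thirdPt p q) k)))) := by
  obtain ⟨ι, hι, ω, ω', a, hω, hω', hid⟩ := harrisForm_eq_sum_coverPairs n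
  have hterm : ∀ (m : Fin 3) (w : ι → Q n 2) (hw0 : ∀ t, w t (a t) = 0) (t : ι),
      InCone (n + 1) (fun C => setInd C (Fin.snoc (Emb p (update (w t) (a t) 1)) m) - setInd C (Fin.snoc (Emb p (w t)) m)) := by
    intro m w hw0 t
    have e0 : Emb p (w t) = update (Emb p (w t)) (a t) (emb (p (a t)) 0) := by
      conv_lhs => rw [← update_eq_self (a t) (w t), hw0 t]
      rw [Emb_update]
    have e1 : update (Fin.snoc (Emb p (w t)) m : Pd (n + 1)) (Fin.castSucc (a t)) (emb (p (a t)) 0) = Fin.snoc (Emb p (w t)) m := by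
      rw [← Fin.snoc_update, ← e0]
    refine (InCone.incr (Fin.snoc (Emb p (w t)) m : Pd (n + 1)) (Fin.castSucc (a t)) (emb_mono (p (a t)))).congr fun C _ => ?_
    rw [Emb_update, Fin.snoc_update, e1]
  refine (InPairCone.sum univ fun t _ => InPairCone.mul (hterm j ω hω t) (hterm k ω' hω' t)).congr fun B C _ _ => ?_
  rw [sum_totDist_eq_sum_Emb p]
  have e2 : (∑ u : Q n 2, setInd B (Fin.snoc (Emb p u) j) * (setInd C (Fin.snoc (Emb p u) k) - setInd C (Fin.snoc (thirdPt p (Emb p u)) k))) =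
      ∑ u : Q n 2, (fun u => setInd B (Fin.snoc (Emb p u) j)) u *
        ((fun u => setInd C (Fin.snoc (Emb p u) k)) u - (fun u => setInd C (Fin.snoc (Emb p u) k)) (antipode u)) :=
    Finset.sum_congr rfl fun u _ => by rw [thirdPt_Emb]
  rw [e2, hid]

/-- The Latin atom re-indexed with the weight at the apex: `Lf W g h = Σ_p W(p) Σ_{q δ̸ p} g(q) h(p̄q)`. [this work] -/
theorem Lf_eq_sum_apex (W g h : Pd n → ℤ) :
    Lf W g h = ∑ p, ∑ q, W p * g q * h (thirdPt p q) * (if TotDist p q = true then (1:ℤ) else 0) := by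
  unfold Lf
  have key : ∀ q : Pd n, (∑ r, g q * h r * W (thirdPt q r) * (if TotDist q r = true then (1:ℤ) else 0)) =
      ∑ p, W p * g q * h (thirdPt p q) * (if TotDist p q = true then (1:ℤ) else 0) := by
    intro q
    rw [← sum_comp_thirdPt q (fun r => g q * h r * W (thirdPt q r) * (if TotDist q r = true then (1:ℤ) else 0))]
    refine Finset.sum_congr rfl fun r _ => ?_
    show g q * h (thirdPt q r) * W (thirdPt q (thirdPt q r)) * (if TotDist q (thirdPt q r) = true then (1:ℤ) else 0) = _
    rw [thirdPt_thirdPt, totDist_thirdPt_right, thirdPt_comm q r, totDist_symm q r]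
    ring
  calc (∑ q, ∑ r, g q * h r * W (thirdPt q r) * (if TotDist q r = true then (1:ℤ) else 0))
      = ∑ q, ∑ p, W p * g q * h (thirdPt p q) * (if TotDist p q = true then (1:ℤ) else 0) := Finset.sum_congr rfl fun q _ => key q
    _ = ∑ p, ∑ q, W p * g q * h (thirdPt p q) * (if TotDist p q = true then (1:ℤ) else 0) := Finset.sum_comm

/-- The horizontal Harris aggregate with a nonnegative apex weight, `Nf W b_j c_k − Lf W b_j c_k = Σ_p W(p)·(fibre Harris form at p)`,
is in the pair cone. [this work] -/
theorem inPairCone_HF (W : Finset (Pd n)) (j k : Fin 3) :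
    InPairCone (n + 1) (fun B C => ((Nf (ind W) (ind (sl B j)) (ind (sl C k)) - Lf (ind W) (ind (sl B j)) (ind (sl C k)) : ℤ) : ℝ)) := by
  have hw : ∀ p ∈ (univ : Finset (Pd n)), (0:ℝ) ≤ (ind W p : ℝ) := fun p _ => by exact_mod_cast ind_nonneg' W p
  refine (InPairCone.sum_smul univ hw fun p _ => InPairCone.fibreHarris₂ p j k).congr fun B C _ _ => ?_
  rw [Lf_eq_sum_apex]
  unfold Nf
  rw [← Finset.sum_sub_distrib]
  push_cast
  refine Finset.sum_congr rfl fun p _ => ?_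
  rw [← Finset.sum_sub_distrib, Finset.mul_sum]
  refine Finset.sum_congr rfl fun q _ => ?_
  simp only [cast_ind_sl]
  ring

set_option maxHeartbeats 2000000 in
/-- The Kleitman diagonal of the threshold `Θ`: `2^{n+1}·Dg(1_Θ; b_j, c_j) − Nf(1_Θ; b_j, c_j) = 2^n Σ_{i∈{1,2}} [Dg(1; b_{ji}−b_{j0}, c_{ji}) + Dg(1; b_{j0}, c_{ji}−c_{j0})]`
along the base's last axis — explicitly in the pair cone. [this work] -/
theorem inPairCone_KD_thr (j : Fin 3) :
    InPairCone (n + 2) (fun B C => ((2 ^ (n + 1) * Dg (ind (Thr n)) (ind (sl B j)) (ind (sl C j)) - Nf (ind (Thr n)) (ind (sl B j)) (ind (sl C j)) : ℤ) : ℝ)) := by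
  have h01 : (0 : Fin 3) ≤ 1 := by decide
  have h02 : (0 : Fin 3) ≤ 2 := by decide
  have F := ((((inPairCone_DgVP (univ : Finset (Pd n)) h01 1).add (inPairCone_DgPV (univ : Finset (Pd n)) 0 h01)).add
    (inPairCone_DgVP (univ : Finset (Pd n)) h02 2)).add (inPairCone_DgPV (univ : Finset (Pd n)) 0 h02)).smul (by positivity : (0:ℝ) ≤ 2 ^ n)
  refine (F.slices j j).congr fun B C _ _ => ?_
  have e : 2 ^ (n + 1) * Dg (ind (Thr n)) (ind (sl B j)) (ind (sl C j)) - Nf (ind (Thr n)) (ind (sl B j)) (ind (sl C j)) =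
      2 ^ n * (Dg (ind (univ : Finset (Pd n))) (ind (sl (sl B j) 1) - ind (sl (sl B j) 0)) (ind (sl (sl C j) 1))
        + Dg (ind (univ : Finset (Pd n))) (ind (sl (sl B j) 0)) (ind (sl (sl C j) 1) - ind (sl (sl C j) 0))
        + Dg (ind (univ : Finset (Pd n))) (ind (sl (sl B j) 2) - ind (sl (sl B j) 0)) (ind (sl (sl C j) 2))
        + Dg (ind (univ : Finset (Pd n))) (ind (sl (sl B j) 0)) (ind (sl (sl C j) 2) - ind (sl (sl C j) 0))) := by
    rw [Dg_snoc3, Nf_snoc6]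
    simp only [fsl_ind, Thr, sl_liftTwo_zero, sl_liftTwo_one, sl_liftTwo_two, ind_empty_fun, Dg_zero₁, Nf_zero₁, Nf_univ₁, Dg_sub₂, Dg_sub₃,
      zero_add, add_zero]
    ring
  rw [e]; push_cast; ring

/-- **The threshold-sandwich remainder is in the pair cone** (for an up-set `X ⊆ Θ`). [this work] -/
theorem remThr_inPairCone {X : Finset (Pd (n + 1))} (hX : IsUpperSet (X : Set (Pd (n + 1)))) :
    InPairCone (n + 2) (fun B C => (remThr X B C : ℝ)) := by
  have h01 : (0 : Fin 3) ≤ 1 := by decide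
  have h12 : (1 : Fin 3) ≤ 2 := by decide
  have h02 : (0 : Fin 3) ≤ 2 := by decide
  have e0 := ((inPairCone_NbV X 0 h12)).smul (by norm_num : (0:ℝ) ≤ 1)
  have e1 := ((inPairCone_NbV X 2 h12)).smul (by norm_num : (0:ℝ) ≤ 2)
  have e2 := ((inPairCone_NcV X 0 h12)).smul (by norm_num : (0:ℝ) ≤ 1)
  have e3 := ((inPairCone_NcV X 2 h12)).smul (by norm_num : (0:ℝ) ≤ 2)
  have e4 := ((inPairCone_VVc X h12 h12)).smul (by norm_num : (0:ℝ) ≤ 1)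
  have e5 := ((inPairCone_VVb X h12 h12)).smul (by norm_num : (0:ℝ) ≤ 1)
  have e6 := (((inPairCone_DgPV (Thr n \ X) 2 h12).smul (by positivity : (0:ℝ) ≤ 2 ^ (n + 1)))).smul (by norm_num : (0:ℝ) ≤ 6)
  have e7 := (((inPairCone_DgVP (Thr n \ X) h12 1).smul (by positivity : (0:ℝ) ≤ 2 ^ (n + 1)))).smul (by norm_num : (0:ℝ) ≤ 6)
  have e8 := (((inPairCone_DgPV (univ : Finset (Pd (n + 1))) 0 h01).smul (by positivity : (0:ℝ) ≤ 2 ^ (n + 1)))).smul (by norm_num : (0:ℝ) ≤ 2)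
  have e9 := (((inPairCone_DgVP (univ : Finset (Pd (n + 1))) h01 1).smul (by positivity : (0:ℝ) ≤ 2 ^ (n + 1)))).smul (by norm_num : (0:ℝ) ≤ 2)
  have e10 := ((inPairCone_VVc (univ : Finset (Pd (n + 1))) h12 h12)).smul (by norm_num : (0:ℝ) ≤ 1)
  have e11 := ((inPairCone_LfVV (univ \ X) h12 h01)).smul (by norm_num : (0:ℝ) ≤ 1)
  have e12 := ((inPairCone_LfVV (univ \ X) h12 h02)).smul (by norm_num : (0:ℝ) ≤ 1)
  have e13 := ((inPairCone_LfVV (univ \ X) h02 h12)).smul (by norm_num : (0:ℝ) ≤ 2)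
  have e14 := ((inPairCone_PV X 1 h01)).smul (by norm_num : (0:ℝ) ≤ 3)
  have e15 := ((inPairCone_VP X h01 0)).smul (by norm_num : (0:ℝ) ≤ 3)
  have e16 := ((inPairCone_Kb hX h01 1)).smul (by norm_num : (0:ℝ) ≤ 2)
  have e17 := ((inPairCone_Kc hX h01 1)).smul (by norm_num : (0:ℝ) ≤ 2)
  have e18 := ((inPairCone_Kb hX h01 2)).smul (by norm_num : (0:ℝ) ≤ 1)
  have e19 := ((inPairCone_Kc hX h01 2)).smul (by norm_num : (0:ℝ) ≤ 1)
  have e20 := ((inPairCone_Kb (isUpperSet_Thr n) h12 0)).smul (by norm_num : (0:ℝ) ≤ 1)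
  have e21 := ((inPairCone_Kc (isUpperSet_Thr n) h12 0)).smul (by norm_num : (0:ℝ) ≤ 1)
  have e22 := ((inPairCone_Kb (isUpperSet_Thr n) h12 2)).smul (by norm_num : (0:ℝ) ≤ 2)
  have e23 := ((inPairCone_Kc (isUpperSet_Thr n) h12 2)).smul (by norm_num : (0:ℝ) ≤ 2)
  have e24 := ((inPairCone_Kb (isUpperSet_Thr n) h02 1)).smul (by norm_num : (0:ℝ) ≤ 1)
  have e25 := ((inPairCone_Kc (isUpperSet_Thr n) h02 1)).smul (by norm_num : (0:ℝ) ≤ 1)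
  have e26 := ((inPairCone_Kb (isUpperSet_Thr n) h02 2)).smul (by norm_num : (0:ℝ) ≤ 2)
  have e27 := ((inPairCone_Kc (isUpperSet_Thr n) h02 2)).smul (by norm_num : (0:ℝ) ≤ 2)
  have e28 := ((inPairCone_HF (univ \ Thr n) 2 2)).smul (by norm_num : (0:ℝ) ≤ 12)
  have e29 := ((inPairCone_KD_thr (n := n) 0)).smul (by norm_num : (0:ℝ) ≤ 1)
  have e30 := ((inPairCone_KD_thr (n := n) 1)).smul (by norm_num : (0:ℝ) ≤ 5)
  refine (((((((((((((((((((((((((((((((e0.add e1).add e2).add e3).add e4).add e5).add e6).add e7).add e8).add e9).add e10).add e11).add e12).add e13).add e14).add e15).add e16).add e17).add e18).add e19).add e20).add e21).add e22).add e23).add e24).add e25).add e26).add e27).add e28).add e29).add e30)).congr fun B C _ _ => ?_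
  simp only [remThr]
  push_cast
  ring

/-- **THE THRESHOLD-TOP SANDWICH LIFT at the format level**: if the up-set `X ⊆ Θ = {x_last ≥ 1} ⊆ [3]^{n+1}` has a pinned (pivotal-pair) certificate,
so does `X × {1} ∪ Θ × {2} ⊆ [3]^{n+2}`. [this work] -/
theorem PinnedGood.thrSand {X : Finset (Pd (n + 1))} (hX : IsUpperSet (X : Set (Pd (n + 1)))) (hXT : X ⊆ Thr n) (h : PinnedGood (n + 1) X) :
    PinnedGood (n + 2) (thrSand X) := by
  have h3 : (0:ℝ) ≤ 1 / 3 := by norm_num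
  refine ((((h.slices 1 1).add (h.slices 2 2)).add ((remThr_inPairCone hX).smul h3))).congr fun B C _ _ => ?_
  have e := sStarD_thrSand_eq hXT B C
  have e' : (sStarD (SahiSlot.thrSand X) B C : ℝ) = sStarD X (sl B 1) (sl C 1) + sStarD X (sl B 2) (sl C 2) + (1 / 3) * (remThr X B C : ℝ) := by
    have := congrArg (fun z : ℤ => (z : ℝ)) e
    push_cast at this
    linarith
  rw [e']

/-- VALUE-LEVEL corollary: `sStarD (X×{1} ∪ Θ×{2}) B C ≥ 0` for all up-sets `B, C`. [this work] -/
theorem sStarD_thrSand_nonneg {X : Finset (Pd (n + 1))} (hX : IsUpperSet (X : Set (Pd (n + 1)))) (hXT : X ⊆ Thr n)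
    (h : PinnedGood (n + 1) X) (B C : Finset (Pd (n + 2))) (hB : IsUpperSet (B : Set (Pd (n + 2)))) (hC : IsUpperSet (C : Set (Pd (n + 2)))) :
    0 ≤ sStarD (thrSand X) B C :=
  (h.thrSand hX hXT).sStarD_nonneg B C hB hC

/-- All-dimension instances: the two-axis sandwiches `D×{(2,1)} ∪ ⊤×{(1,2),(2,2)}` and `D×{(1,1)} ∪ ⊤×{(1,2),(2,1),(2,2)}` of a pinned-good `D`. [this work] -/
theorem pinnedGood_thrSand_liftTop {D : Finset (Pd n)} (hD : IsUpperSet (D : Set (Pd n))) (h : PinnedGood n D) :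
    PinnedGood (n + 2) (thrSand (liftTop D)) :=
  (h.liftTop hD).thrSand (isUpperSet_liftTop hD) (fun x hx => by
    simp only [liftTop, Thr, liftTwo, Finset.mem_filter, Finset.mem_univ, true_and] at hx ⊢
    rw [hx.2]; decide)

/-- … and the sandwich of a sandwich. [this work] -/
theorem pinnedGood_thrSand_topSand {D : Finset (Pd n)} (hD : IsUpperSet (D : Set (Pd n))) (h : PinnedGood n D) :
    PinnedGood (n + 2) (thrSand (topSand D)) :=
  (h.topSand hD).thrSand (isUpperSet_topSand hD) (fun x hx => by
    simp only [topSand, liftTop, Thr, liftTwo, Finset.mem_union, Finset.mem_filter, Finset.mem_univ, true_and] at hx ⊢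
    rcases hx with hx | hx
    · exact hx.2
    · rw [hx]; decide)

end SahiSlot

end Summit.CriticalPhenomena.PercolationContinuityZ3.Theorems
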